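import Literature.Geometry.Kaehler.SiegelTorusThetaDivisorEtaModular
import Mathlib.LinearAlgebra.Projectivization.Basic
import HarnessLib

/-!
# The Gauss map of the theta divisor is `Sp_{2g}(ℤ)`-equivariant: `G_{M(Z)}(ᵗD⁻¹v) = [dϑ(v) ∘ ᵗD]`,
# the smooth loci and the Gauss images of `Θ_Z` and `Θ_{M(Z)}` correspond under `ℙ(ᵗ(γZ+δ))`

[tag: lange-cav-complex-tori] [linked: HodgeConjecture (lit-hodgefound SKELETON §A2, row A2-214)]

Layer `Literature/Geometry/Kaehler`, namespace `Literature.Geometry.Kaehler.ComplexTorus`; lane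
`lit-hodgefound` (Track 2 foundations library), skeleton seat `lit-hodgefound-skel-2` (generation 43), plan
row A2-214 — the projective reading of A2-210's gradient transformation law
(`fderiv_riemannThetaChar_moeb_mulVec_eq_of_eq_zero`: on `ϑ[c](v,Z) = 0`,
`dϑ[M[c]](·,M(Z))(ᵗD⁻¹v)(ᵗD⁻¹u) = C q(v) dϑ[c](·,Z)(v)(u)`, `D = γZ+δ`): the Gauss VALUES, the smooth loci
and the Gauss IMAGES of the theta divisors of `Z` and `M(Z)` correspond under the projectivity
`[ℓ] ↦ [ℓ ∘ ᵗD]` of `ℙ((ℂ^g)^*)`. Theorems only; no definition, no named fact.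

Sources, VERBATIM. R. de Jong, *Theta functions on the theta divisor*, Rocky Mountain J. Math. 40 (2010)
[held `paper:arxiv-math_0611810`], §4, proof of Thm. 1.3 (chunk p0008 L56–L61): "For `(z,τ)` with
`θ(z,τ)=0` we have […] `( θ_i(ᵗ(cτ+d)⁻¹z, (aτ+b)(cτ+d)⁻¹) ) = ᵗ(cτ+d) ζ_γ det(cτ+d)^{1/2} q(z,γ,τ)
( θ_i(z,τ) )`." S. Grushevsky, R. Salvati Manni, Proc. AMS 136 (2008) [held `paper:arxiv-math_0605160`
family], Definition 5 (p0004 of the held text: the action `τ ↦ (ατ+β)(γτ+δ)⁻¹`, `z ↦ ᵗ(γτ+δ)⁻¹z`, the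
characteristic `M[ε;δ]`). H. Lange, *Abelian Varieties over the Complex Numbers* (2023), §2.1.2 (p. 80:
"`G(w̄) = (∂ϑ/∂v_1(w) : ⋯ : ∂ϑ/∂v_g(w))`" — the Gauss map in coordinates, defined up to the projectivity
induced by a change of coordinates). Ch. Birkenhake, H. Lange, *Complex Abelian Varieties* (1992), §2.2.3
(p. 94: `G : D_s → ℙ^{g−1} = ℙ(V^*)` for any reduced divisor of a positive line bundle).

Dictionary. `F = ϑ[a;b](·, Z)`, `F′ = ϑ[M[a;b]](·, M(Z))` (`thetaCharFst/Snd M a b`, `moeb`),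
`D = denom(M, Z) = γZ + δ`, `T_D = (w ↦ ᵗD w)` as a continuous linear map
(`LinearMap.toContinuousLinearMap (Matrix.toLin' Dᵀ)`); Gauss value `[dF(v)] = Projectivization.mk ℂ (dF(v))`.

## Contents

* §1 `transpose_denom_inv_mulVec_mulVec`, `transpose_denom_mulVec_inv_mulVec` (`ᵗD⁻¹ᵗD w = w`,
  `ᵗDᵗD⁻¹v = v`), `comp_transpose_denom_ne_zero` (`ℓ ≠ 0 ⟹ ℓ ∘ T_D ≠ 0`).
* §2 **`fderiv_riemannThetaChar_moeb_mulVec_eq_smul_comp`** (`dF′(ᵗD⁻¹v) = C q(v) • dF(v) ∘ T_D` on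
  `F(v) = 0` — "`(θ_i(ᵗ(cτ+d)⁻¹z, γ·τ)) = ᵗ(cτ+d) ζ_γ det^{1/2} q (θ_i(z,τ))`"),
  **`fderiv_riemannThetaChar_moeb_mulVec_eq_zero_iff`** (THE SMOOTH LOCI CORRESPOND: `dF′(ᵗD⁻¹v) = 0 ↔
  dF(v) = 0`).
* §3 **`mk_fderiv_riemannThetaChar_moeb_mulVec_eq`** (THE GAUSS MAP IS EQUIVARIANT:
  `G_{M(Z)}(ᵗD⁻¹v) = [dF(v) ∘ T_D]`), **`exists_mk_fderiv_riemannThetaChar_moeb_iff`** (THE GAUSS IMAGES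
  CORRESPOND: `p` is a Gauss value of `Θ_{M(Z)}` iff `p = [ℓ ∘ T_D]` for a Gauss value `[ℓ]` of `Θ_Z`).

## References

* [DeJong2010ThetaFunctionsThetaDivisor] R. de Jong, Theta functions on the theta divisor, Rocky Mountain
  J. Math. 40 (2010), §4 (proof of Thm. 1.3).
* [GrushevskySalvatiManni2008] S. Grushevsky, R. Salvati Manni, Proc. AMS 136 (2008), Definition 5.
* [Lange2023AbelianVarietiesComplex] H. Lange, Abelian Varieties over the Complex Numbers (2023), §2.1.2.
* [LangeBirkenhake1992] Ch. Birkenhake, H. Lange, Complex Abelian Varieties (1992), §2.2.3 (p. 94).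
-/

noncomputable section

open scoped Matrix Topology Real
open Set Function Module Complex Matrix
open Literature.Analysis.SpecialFunctions Literature.Analysis.Complex

namespace Literature.Geometry.Kaehler

namespace ComplexTorus

open Literature.NumberTheory.Automorphic (siegelUpperHalfSpace)
open Literature.NumberTheory.ModularForms.SiegelUpperHalfSpace (moeb denom)

section GaussModular

variable {n : ℕ} {M : Matrix (Fin n ⊕ Fin n) (Fin n ⊕ Fin n) ℤ} {Z : Matrix (Fin n) (Fin n) ℂ}

/-! ### §1 The invertible matrix `ᵗD`, `D = γZ + δ` -/

/-- `ᵗD⁻¹ (ᵗD w) = w`. [cite: GrushevskySalvatiManni2008, Definition 5 (p0004 of the held text: "`z ↦ ᵗ(γτ+δ)⁻¹z`")] -/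
theorem transpose_denom_inv_mulVec_mulVec (hM : M ∈ Matrix.symplecticGroup (Fin n) ℤ)
    (hZ : Z ∈ siegelUpperHalfSpace n) (w : Fin n → ℂ) :
    (denom (M.map ((↑) : ℤ → ℂ)) Z)ᵀ⁻¹ *ᵥ ((denom (M.map ((↑) : ℤ → ℂ)) Z)ᵀ *ᵥ w) = w := by
  have hDu : IsUnit (denom (M.map ((↑) : ℤ → ℂ)) Z)ᵀ.det := by
    rw [Matrix.det_transpose]
    exact isUnit_det_denom_intCast hM hZ
  rw [Matrix.mulVec_mulVec, Matrix.nonsing_inv_mul _ hDu, Matrix.one_mulVec]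

/-- `ᵗD (ᵗD⁻¹ v) = v`. [cite: GrushevskySalvatiManni2008, Definition 5 (p0004 of the held text)] -/
theorem transpose_denom_mulVec_inv_mulVec (hM : M ∈ Matrix.symplecticGroup (Fin n) ℤ)
    (hZ : Z ∈ siegelUpperHalfSpace n) (v : Fin n → ℂ) :
    (denom (M.map ((↑) : ℤ → ℂ)) Z)ᵀ *ᵥ ((denom (M.map ((↑) : ℤ → ℂ)) Z)ᵀ⁻¹ *ᵥ v) = v := by
  have hDu : IsUnit (denom (M.map ((↑) : ℤ → ℂ)) Z)ᵀ.det := by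
    rw [Matrix.det_transpose]
    exact isUnit_det_denom_intCast hM hZ
  rw [Matrix.mulVec_mulVec, Matrix.mul_nonsing_inv _ hDu, Matrix.one_mulVec]

/-- A non-zero covector stays non-zero after composition with the invertible `T_D = (w ↦ ᵗD w)`.
[cite: DeJong2010ThetaFunctionsThetaDivisor, §4, proof of Thm. 1.3 (chunk p0008)] -/
theorem comp_transpose_denom_ne_zero (hM : M ∈ Matrix.symplecticGroup (Fin n) ℤ)
    (hZ : Z ∈ siegelUpperHalfSpace n) {ℓ : (Fin n → ℂ) →L[ℂ] ℂ} (hℓ : ℓ ≠ 0) :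
    ℓ.comp (LinearMap.toContinuousLinearMap (Matrix.toLin' (denom (M.map ((↑) : ℤ → ℂ)) Z)ᵀ)) ≠ 0 := by
  intro h
  apply hℓ
  refine ContinuousLinearMap.ext fun u => ?_
  have hu := congrArg (fun T : (Fin n → ℂ) →L[ℂ] ℂ => T ((denom (M.map ((↑) : ℤ → ℂ)) Z)ᵀ⁻¹ *ᵥ u)) h
  simp only [ContinuousLinearMap.comp_apply, LinearMap.coe_toContinuousLinearMap', Matrix.toLin'_apply,
    _root_.zero_apply] at hu
  rwa [transpose_denom_mulVec_inv_mulVec hM hZ u] at hu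

/-! ### §2 The gradient on `ϑ = 0` transforms by `ᵗD` and a unit -/

/-- **`dϑ[M[c]](·, M(Z))(ᵗD⁻¹v) = C q(v) • dϑ[c](·, Z)(v) ∘ T_D` on `ϑ[c](v, Z) = 0`** — "`( θ_i(ᵗ(cτ+d)⁻¹z,
(aτ+b)(cτ+d)⁻¹) ) = ᵗ(cτ+d) ζ_γ det(cτ+d)^{1/2} q(z,γ,τ) ( θ_i(z,τ) )`": the covector `dϑ′` at the
corresponding point is the covector `dϑ` precomposed with `ᵗD`, times a unit.
[cite: DeJong2010ThetaFunctionsThetaDivisor, §4, proof of Thm. 1.3 (chunk p0008 L56–L61)] [cite: GrushevskySalvatiManni2008, Definition 5 (p0004 of the held text)] -/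
theorem fderiv_riemannThetaChar_moeb_mulVec_eq_smul_comp (hM : M ∈ Matrix.symplecticGroup (Fin n) ℤ)
    (hZ : Z ∈ siegelUpperHalfSpace n) (a b : Fin n → ℂ) :
    ∃ C : ℂ, C ≠ 0 ∧ ∀ v : Fin n → ℂ, riemannThetaChar a b Z v = 0 →
      fderiv ℂ (riemannThetaChar (thetaCharFst M a b) (thetaCharSnd M a b) (moeb (M.map ((↑) : ℤ → ℂ)) Z))
          ((denom (M.map ((↑) : ℤ → ℂ)) Z)ᵀ⁻¹ *ᵥ v) =
        (C * cexp (π * I * (v ⬝ᵥ ((denom (M.map ((↑) : ℤ → ℂ)) Z)⁻¹ *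
            (M.map ((↑) : ℤ → ℂ)).toBlocks₂₁) *ᵥ v))) •
          (fderiv ℂ (riemannThetaChar a b Z) v).comp
            (LinearMap.toContinuousLinearMap (Matrix.toLin' (denom (M.map ((↑) : ℤ → ℂ)) Z)ᵀ)) := by
  obtain ⟨C, hC, h⟩ := fderiv_riemannThetaChar_moeb_mulVec_eq_of_eq_zero hM hZ a b
  refine ⟨C, hC, fun v hv => ContinuousLinearMap.ext fun w => ?_⟩
  have hw := h v hv ((denom (M.map ((↑) : ℤ → ℂ)) Z)ᵀ *ᵥ w)
  rw [transpose_denom_inv_mulVec_mulVec hM hZ w] at hw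
  rw [hw, _root_.smul_apply, ContinuousLinearMap.comp_apply, LinearMap.coe_toContinuousLinearMap',
    Matrix.toLin'_apply, smul_eq_mul]

/-- **THE SMOOTH LOCI CORRESPOND**: on `ϑ[c](v, Z) = 0`, `dϑ[M[c]](·, M(Z))(ᵗD⁻¹v) = 0 ↔ dϑ[c](·, Z)(v) = 0`
— `ᵗD⁻¹` maps `Sing` to `Sing` and the smooth part to the smooth part of the corresponding theta divisors.
[cite: DeJong2010ThetaFunctionsThetaDivisor, §4, proof of Thm. 1.3 (chunk p0008)] [cite: GrushevskySalvatiManni2008, Definition 5 (p0004 of the held text)] -/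
theorem fderiv_riemannThetaChar_moeb_mulVec_eq_zero_iff (hM : M ∈ Matrix.symplecticGroup (Fin n) ℤ)
    (hZ : Z ∈ siegelUpperHalfSpace n) (a b : Fin n → ℂ) {v : Fin n → ℂ}
    (hv : riemannThetaChar a b Z v = 0) :
    fderiv ℂ (riemannThetaChar (thetaCharFst M a b) (thetaCharSnd M a b) (moeb (M.map ((↑) : ℤ → ℂ)) Z))
        ((denom (M.map ((↑) : ℤ → ℂ)) Z)ᵀ⁻¹ *ᵥ v) = 0 ↔
      fderiv ℂ (riemannThetaChar a b Z) v = 0 := by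
  obtain ⟨C, hC, h⟩ := fderiv_riemannThetaChar_moeb_mulVec_eq_smul_comp hM hZ a b
  have hq : C * cexp (π * I * (v ⬝ᵥ ((denom (M.map ((↑) : ℤ → ℂ)) Z)⁻¹ *
      (M.map ((↑) : ℤ → ℂ)).toBlocks₂₁) *ᵥ v)) ≠ 0 := mul_ne_zero hC (Complex.exp_ne_zero _)
  rw [h v hv]
  constructor
  · intro h0
    by_contra hne
    have h1 := comp_transpose_denom_ne_zero hM hZ hne
    apply h1
    refine ContinuousLinearMap.ext fun w => ?_
    have h2 := congrArg (fun T : (Fin n → ℂ) →L[ℂ] ℂ => T w) h0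
    simp only [_root_.smul_apply, _root_.zero_apply, smul_eq_mul] at h2
    rw [_root_.zero_apply]
    exact (mul_eq_zero.1 h2).resolve_left hq
  · intro h0
    rw [h0, ContinuousLinearMap.zero_comp]
    refine ContinuousLinearMap.ext fun w => ?_
    rw [_root_.smul_apply, _root_.zero_apply, smul_eq_mul, mul_zero]

/-! ### §3 The Gauss values and the Gauss images correspond under `[ℓ] ↦ [ℓ ∘ ᵗD]` -/

/-- **THE GAUSS MAP IS `Sp_{2g}(ℤ)`-EQUIVARIANT**: at a smooth point `v` of `{ϑ[c](·,Z) = 0}`, the Gauss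
value of `Θ_{M(Z)}` (characteristic `M[c]`) at the corresponding point `ᵗD⁻¹v` is the image of the Gauss
value `[dϑ[c](v)]` under the projectivity `[ℓ] ↦ [ℓ ∘ ᵗD]` of `ℙ((ℂ^g)^*)` — "`(θ_i(ᵗ(cτ+d)⁻¹z, γ·τ)) =
ᵗ(cτ+d) · (unit) · (θ_i(z,τ))`". [cite: DeJong2010ThetaFunctionsThetaDivisor, §4, proof of Thm. 1.3 (chunk p0008 L56–L61)] [cite: Lange2023AbelianVarietiesComplex, §2.1.2 (p. 80: "`G(w̄) = (∂ϑ/∂v_1(w) : ⋯ : ∂ϑ/∂v_g(w))`")] -/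
theorem mk_fderiv_riemannThetaChar_moeb_mulVec_eq (hM : M ∈ Matrix.symplecticGroup (Fin n) ℤ)
    (hZ : Z ∈ siegelUpperHalfSpace n) (a b : Fin n → ℂ) {v : Fin n → ℂ}
    (hv : riemannThetaChar a b Z v = 0) (hd : fderiv ℂ (riemannThetaChar a b Z) v ≠ 0)
    (hd' : fderiv ℂ (riemannThetaChar (thetaCharFst M a b) (thetaCharSnd M a b)
      (moeb (M.map ((↑) : ℤ → ℂ)) Z)) ((denom (M.map ((↑) : ℤ → ℂ)) Z)ᵀ⁻¹ *ᵥ v) ≠ 0) :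
    Projectivization.mk ℂ (fderiv ℂ (riemannThetaChar (thetaCharFst M a b) (thetaCharSnd M a b)
        (moeb (M.map ((↑) : ℤ → ℂ)) Z)) ((denom (M.map ((↑) : ℤ → ℂ)) Z)ᵀ⁻¹ *ᵥ v)) hd' =
      Projectivization.mk ℂ ((fderiv ℂ (riemannThetaChar a b Z) v).comp
        (LinearMap.toContinuousLinearMap (Matrix.toLin' (denom (M.map ((↑) : ℤ → ℂ)) Z)ᵀ)))
        (comp_transpose_denom_ne_zero hM hZ hd) := by
  obtain ⟨C, -, h⟩ := fderiv_riemannThetaChar_moeb_mulVec_eq_smul_comp hM hZ a b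
  rw [Projectivization.mk_eq_mk_iff']
  exact ⟨_, (h v hv).symm⟩

/-- **THE GAUSS IMAGES CORRESPOND**: a point `p ∈ ℙ((ℂ^g)^*)` is a Gauss value of `Θ_{M(Z)}` (at some smooth
point `w` of `{ϑ[M[c]](·,M(Z)) = 0}`) iff `p = [ℓ ∘ ᵗD]` for a Gauss value `[ℓ] = [dϑ[c](v)]` of `Θ_Z` (at a
smooth point `v` of `{ϑ[c](·,Z) = 0}`; `w = ᵗD⁻¹v`) — the Gauss image, its degree and its linear span are
invariants of the `Sp_{2g}(ℤ)`-orbit up to the projectivity `ℙ(ᵗ(γZ+δ))`.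
[cite: DeJong2010ThetaFunctionsThetaDivisor, §4, proof of Thm. 1.3 (chunk p0008)] [cite: LangeBirkenhake1992, §2.2.3 (p. 94: "`G : D_s → ℙ_{g−1} = ℙ(V^*)`")] -/
theorem exists_mk_fderiv_riemannThetaChar_moeb_iff (hM : M ∈ Matrix.symplecticGroup (Fin n) ℤ)
    (hZ : Z ∈ siegelUpperHalfSpace n) (a b : Fin n → ℂ) (p : Projectivization ℂ ((Fin n → ℂ) →L[ℂ] ℂ)) :
    (∃ (w : Fin n → ℂ) (h : fderiv ℂ (riemannThetaChar (thetaCharFst M a b) (thetaCharSnd M a b)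
        (moeb (M.map ((↑) : ℤ → ℂ)) Z)) w ≠ 0),
        riemannThetaChar (thetaCharFst M a b) (thetaCharSnd M a b) (moeb (M.map ((↑) : ℤ → ℂ)) Z) w = 0 ∧
          Projectivization.mk ℂ (fderiv ℂ (riemannThetaChar (thetaCharFst M a b) (thetaCharSnd M a b)
            (moeb (M.map ((↑) : ℤ → ℂ)) Z)) w) h = p) ↔
      ∃ (v : Fin n → ℂ) (h : fderiv ℂ (riemannThetaChar a b Z) v ≠ 0),
        riemannThetaChar a b Z v = 0 ∧
          Projectivization.mk ℂ ((fderiv ℂ (riemannThetaChar a b Z) v).comp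
            (LinearMap.toContinuousLinearMap (Matrix.toLin' (denom (M.map ((↑) : ℤ → ℂ)) Z)ᵀ)))
            (comp_transpose_denom_ne_zero hM hZ h) = p := by
  constructor
  · rintro ⟨w, h, hw0, hp⟩
    -- `w = ᵗD⁻¹ v` with `v = ᵗD w`
    set v : Fin n → ℂ := (denom (M.map ((↑) : ℤ → ℂ)) Z)ᵀ *ᵥ w with hv
    have hw : (denom (M.map ((↑) : ℤ → ℂ)) Z)ᵀ⁻¹ *ᵥ v = w := transpose_denom_inv_mulVec_mulVec hM hZ w
    have hv0 : riemannThetaChar a b Z v = 0 := by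
      rw [← riemannThetaChar_moeb_mulVec_eq_zero_iff hM hZ a b v, hw]
      exact hw0
    have h' : fderiv ℂ (riemannThetaChar (thetaCharFst M a b) (thetaCharSnd M a b)
        (moeb (M.map ((↑) : ℤ → ℂ)) Z)) ((denom (M.map ((↑) : ℤ → ℂ)) Z)ᵀ⁻¹ *ᵥ v) ≠ 0 := by
      rw [hw]
      exact h
    have hdv : fderiv ℂ (riemannThetaChar a b Z) v ≠ 0 := fun h0 =>
      h' ((fderiv_riemannThetaChar_moeb_mulVec_eq_zero_iff hM hZ a b hv0).2 h0)
    refine ⟨v, hdv, hv0, ?_⟩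
    rw [← mk_fderiv_riemannThetaChar_moeb_mulVec_eq hM hZ a b hv0 hdv h', ← hp]
    exact (Projectivization.mk_eq_mk_iff' ..).2 ⟨1, by rw [one_smul, hw]⟩
  · rintro ⟨v, h, hv0, hp⟩
    have h' : fderiv ℂ (riemannThetaChar (thetaCharFst M a b) (thetaCharSnd M a b)
        (moeb (M.map ((↑) : ℤ → ℂ)) Z)) ((denom (M.map ((↑) : ℤ → ℂ)) Z)ᵀ⁻¹ *ᵥ v) ≠ 0 := fun h0 =>
      h ((fderiv_riemannThetaChar_moeb_mulVec_eq_zero_iff hM hZ a b hv0).1 h0)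
    refine ⟨(denom (M.map ((↑) : ℤ → ℂ)) Z)ᵀ⁻¹ *ᵥ v, h', ?_, ?_⟩
    · exact (riemannThetaChar_moeb_mulVec_eq_zero_iff hM hZ a b v).2 hv0
    · rw [mk_fderiv_riemannThetaChar_moeb_mulVec_eq hM hZ a b hv0 h h', hp]

end GaussModular

end ComplexTorus

end Literature.Geometry.Kaehler
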